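import Summits.RiemannHypothesis.RiemannHypothesis.Theses.WeilWindowFlow
import Literature.NumberTheory.LFunctions.WeilGroundState
import Literature.NumberTheory.LFunctions.WeilWindowSuzukiProofs

/-!
# `GronwallLeakage` (crux stmt-RiemannHypothesis-1037) — structure theorem (necessary conditions)

What the crux `X = GronwallLeakage` of route WeilWindowFlow SAYS, kernel-checked (refuter's standing
adversary, cdisprove cycle 1): with the PROVED coercive anchor (`exists_weilGroundEnergy_pos`,
Bombieri 2000 Thm 12 / Suzuki Thm 1.4),

  `X ⟺ (∀ a > 0, 0 < ε a) ∧ (∀ 0 < b ≤ a, AbsolutelyContinuousOnInterval (log ∘ ε) b a)`,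

`ε = weilGroundEnergy`. Hence `¬X ⟺ (∃ a > 0, ε a ≤ 0) ∨ (log ε has a singular part on some compact
window range)`: a conjugate point or a singular drop — kinks / vertical tangents of `ε` at prime-power
entries `a = (log n)/2` do NOT contradict `X` (a continuous antitone function AC off a finite set is AC).

* `weilGroundEnergy_pos_of_gronwallLeakage` — `X` forces strict positivity at every window;
* `gronwallLeakage_log_form` — log form `0 ≤ log ε b - log ε a ≤ ∫_b^a C`;
* `absolutelyContinuousOnInterval_of_dist_le` — comparison principle for absolute continuity;
* `logAC_of_gronwallLeakage` — `X` ⟹ `log ε` AC on every `[b, a] ⊂ (0, ∞)`;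
* `gronwallLeakage_iff_pos_and_logAC` — the equivalence (reverse direction: `C := -deriv (log ∘ ε)`,
  FTC for absolutely continuous functions, `AbsolutelyContinuousOnInterval.integral_deriv_eq_sub`).

Axioms ⊆ {propext, Classical.choice, Quot.sound}.
-/

noncomputable section

open MeasureTheory Set Filter

namespace Summit.RiemannHypothesis.Cruxes.GronwallLeakage.Negative

open Literature.NumberTheory.LFunctions
open Summit.RiemannHypothesis.RiemannHypothesis.Theses.WeilWindowFlow

/-- `ε` is antitone on `(0, ∞)` (restated here to keep the file self-contained). [folklore] -/
theorem weilGroundEnergy_antitone_of_pos' {b a : ℝ} (hb : 0 < b) (hba : b ≤ a) :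
    weilGroundEnergy a ≤ weilGroundEnergy b := by
  refine csInf_le_csInf (bddBelow_weilQuadratic_sphere_holds a) ?_ ?_
  · obtain ⟨g, hg, hsupp, hnorm⟩ := exists_isWeilTest_sphere hb
    exact ⟨_, g, hg, hsupp, hnorm, rfl⟩
  · rintro x ⟨g, hg, hsupp, hnorm, rfl⟩
    exact ⟨g, hg, hsupp.trans (Icc_subset_Icc (by linarith) hba), hnorm, rfl⟩

/-- `X` forces STRICT positivity of the bottom at every window: `ε(a₁) > 0` on small windows
(`exists_weilGroundEnergy_pos`) is transported by the leakage law. [folklore] -/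
theorem weilGroundEnergy_pos_of_gronwallLeakage (hX : GronwallLeakage) {a : ℝ} (ha : 0 < a) :
    0 < weilGroundEnergy a := by
  obtain ⟨a₁, ha₁, H⟩ := exists_weilGroundEnergy_pos
  by_cases hle : a ≤ a₁
  · exact H a ha hle
  · obtain ⟨C, hC⟩ := hX
    exact lt_of_lt_of_le (mul_pos (H a₁ ha₁ le_rfl) (Real.exp_pos _))
      (hC a₁ a ha₁ (le_of_not_ge hle)).2

/-- Log form of the law for a witness of `X`: `0 ≤ log ε b - log ε a ≤ ∫_b^a C` for `0 < b ≤ a`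
(all quantities finite since `ε > 0`; the lower bound is antitonicity). [folklore] -/
theorem gronwallLeakage_log_form (hX : GronwallLeakage) :
    ∃ C : ℝ → ℝ, ∀ b a : ℝ, 0 < b → b ≤ a → IntervalIntegrable C volume b a ∧
      0 ≤ Real.log (weilGroundEnergy b) - Real.log (weilGroundEnergy a) ∧
      Real.log (weilGroundEnergy b) - Real.log (weilGroundEnergy a) ≤ ∫ x in b..a, C x := by
  have hpos := fun a (ha : 0 < a) ↦ weilGroundEnergy_pos_of_gronwallLeakage hX ha
  obtain ⟨C, hC⟩ := hX
  refine ⟨C, fun b a hb hba ↦ ⟨(hC b a hb hba).1, ?_, ?_⟩⟩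
  · have := Real.log_le_log (hpos a (hb.trans_le hba)) (weilGroundEnergy_antitone_of_pos' hb hba)
    linarith
  · have h := (hC b a hb hba).2
    have hb' := hpos b hb
    have h' := Real.log_le_log (mul_pos hb' (Real.exp_pos _)) h
    rw [Real.log_mul hb'.ne' (Real.exp_pos _).ne', Real.log_exp] at h'
    linarith

/-- Comparison principle: a function whose oscillation is dominated by that of an absolutely
continuous function is absolutely continuous. [folklore] -/
theorem absolutelyContinuousOnInterval_of_dist_le {f G : ℝ → ℝ} {a b : ℝ}
    (hG : AbsolutelyContinuousOnInterval G a b)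
    (h : ∀ x ∈ uIcc a b, ∀ y ∈ uIcc a b, dist (f x) (f y) ≤ dist (G x) (G y)) :
    AbsolutelyContinuousOnInterval f a b := by
  rw [absolutelyContinuousOnInterval_iff] at hG ⊢
  intro ε hε
  obtain ⟨δ, hδ, hG⟩ := hG ε hε
  refine ⟨δ, hδ, fun E hE₁ hE₂ ↦ lt_of_le_of_lt ?_ (hG E hE₁ hE₂)⟩
  exact Finset.sum_le_sum fun i hi ↦ h _ (hE₁.1 i hi).1 _ (hE₁.1 i hi).2

/-- `X` ⟹ `log ε` is absolutely continuous on every `[b, a] ⊂ (0, ∞)`: its oscillation is dominated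
by that of the primitive `x ↦ ∫_b^x |C|`, which is absolutely continuous
(`IntervalIntegrable.absolutelyContinuousOnInterval_intervalIntegral`). [folklore] -/
theorem logAC_of_gronwallLeakage (hX : GronwallLeakage) {b a : ℝ} (hb : 0 < b) (hba : b ≤ a) :
    AbsolutelyContinuousOnInterval (fun x ↦ Real.log (weilGroundEnergy x)) b a := by
  obtain ⟨C, hC⟩ := gronwallLeakage_log_form hX
  have hint : IntervalIntegrable (fun x ↦ |C x|) volume b a := (hC b a hb hba).1.abs
  set G : ℝ → ℝ := fun x ↦ ∫ v in b..x, |C v| with hGdef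
  have hG : AbsolutelyContinuousOnInterval G b a :=
    hint.absolutelyContinuousOnInterval_intervalIntegral (c := b) (by simp)
  have key : ∀ x y : ℝ, b ≤ x → x ≤ y → y ≤ a →
      dist (Real.log (weilGroundEnergy x)) (Real.log (weilGroundEnergy y)) ≤ dist (G x) (G y) := by
    intro x y hx hxy hy
    obtain ⟨-, h0, h1⟩ := hC x y (hb.trans_le hx) hxy
    have h2 : ∫ v in x..y, C v ≤ ∫ v in x..y, |C v| :=
      (le_abs_self _).trans (intervalIntegral.abs_integral_le_integral_abs hxy)
    have hGxy : G y - G x = ∫ v in x..y, |C v| := by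
      simp only [hGdef]
      rw [intervalIntegral.integral_interval_sub_left
        (hint.mono_set (by rw [uIcc_of_le hba, uIcc_of_le (hx.trans hxy)]
                           exact Icc_subset_Icc le_rfl hy))
        (hint.mono_set (by rw [uIcc_of_le hba, uIcc_of_le hx]
                           exact Icc_subset_Icc le_rfl (hxy.trans hy)))]
    have h3 : 0 ≤ ∫ v in x..y, |C v| :=
      intervalIntegral.integral_nonneg hxy fun v _ ↦ abs_nonneg _
    rw [Real.dist_eq, Real.dist_eq, abs_of_nonneg h0, abs_sub_comm, hGxy, abs_of_nonneg h3]
    exact h1.trans h2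
  refine absolutelyContinuousOnInterval_of_dist_le hG fun x hx y hy ↦ ?_
  rw [uIcc_of_le hba] at hx hy
  rcases le_total x y with hxy | hyx
  · exact key x y hx.1 hxy hy.2
  · rw [dist_comm, dist_comm (G x)]
    exact key y x hy.1 hyx hx.2

/-- STRUCTURE THEOREM. `X ⟺ (ε > 0 at every window) ∧ (log ε absolutely continuous on every
[b, a] ⊂ (0, ∞))`; the reverse direction takes the rate `C := -deriv (log ∘ ε)` and the FTC for
absolutely continuous functions (`AbsolutelyContinuousOnInterval.integral_deriv_eq_sub`), with equality
in the law. So `¬X ⟺ (∃ a > 0, ε a ≤ 0) ∨ (log ε has a singular part on some compact window range)`.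
[folklore] -/
theorem gronwallLeakage_iff_pos_and_logAC :
    GronwallLeakage ↔
      (∀ a : ℝ, 0 < a → 0 < weilGroundEnergy a) ∧
      (∀ b a : ℝ, 0 < b → b ≤ a →
        AbsolutelyContinuousOnInterval (fun x ↦ Real.log (weilGroundEnergy x)) b a) := by
  constructor
  · exact fun hX ↦ ⟨fun a ha ↦ weilGroundEnergy_pos_of_gronwallLeakage hX ha,
      fun b a hb hba ↦ logAC_of_gronwallLeakage hX hb hba⟩
  · rintro ⟨hpos, hAC⟩
    refine ⟨fun x ↦ -deriv (fun y ↦ Real.log (weilGroundEnergy y)) x, fun b a hb hba ↦ ⟨?_, ?_⟩⟩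
    · exact (hAC b a hb hba).intervalIntegrable_deriv.neg
    · rw [intervalIntegral.integral_neg, neg_neg, (hAC b a hb hba).integral_deriv_eq_sub]
      have hb' := hpos b hb
      have ha' := hpos a (hb.trans_le hba)
      rw [Real.exp_sub, Real.exp_log ha', Real.exp_log hb', mul_div_cancel₀ _ hb'.ne']

end Summit.RiemannHypothesis.Cruxes.GronwallLeakage.Negative

end
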